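import Mathlib
import HarnessLib
import Summits.NavierStokesRegularity.NavierStokesRegularity.Theorems.HalfSpaceWindowDoorCirculationCarryingRigidityEddyTorqueStrata
import Summits.NavierStokesRegularity.NavierStokesRegularity.Theorems.AxisTwistDoorAveragedConeLiouvilleRadialDrift

/-!
# Route `HalfSpaceWindowDoor`, crux `CirculationCarryingRigidity` (stmt-NavierStokesRegularity-25311) — the ONE-SIDED eddy-torque
# condition makes the axis circulation a SUBSOLUTION with a divergence-free drift (brick 0 of the recommended next engine)

Line `eddy_torque` (LEAD ns-hsw-p1 g4).  The landed census theorem (`…EddyTorqueLiouville`) needs the TWO-SIDED bound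
`|ℛ| ≤ A/(r+√(−s))·∮ω₃` because KNSS's Lemma 2.1 (pointwise propagation of near-maximality) is a statement about SOLUTIONS.  The
natural sharper census row — only eddy SPIN-UP must be slaved to the mean vertical vorticity, spin-down is free — needs a
positivity-propagation (weak Harnack) framework for SUPERsolutions `V = M − F`, which the tree now has
(AxisTwistDoor `…PositivityFactC.positivityPropagationFactC_holds`, general bounded divergence-free `C¹` drift).  This file
provides the pointwise input of that framework:

* `circF_subsolution_of_oneSided` — for a door-class profile, off the axis, at `s < 0`: the one-sided bound
  `ℛ ≤ (A'/r)·∮ω₃ dl` on the axis circle through `x` gives `∂ₛF − ΔF + DF[b] ≤ 0` at `(s,x)` for `F = (2π)⁻¹Γ`, with the drift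
  `b = ⟨v(s)⟩_θ(x) + ((2 − A')/r²)·x_h` (angular-mean velocity + AxisTwistDoor's radial comparison drift); i.e.
  `V = M − F` satisfies `∂ₛV − ΔV + ⟪b, ∇V⟫ ≥ 0`;
* `divergence_drift_eq_zero` — `div b = 0` off the axis (`div⟨v⟩_θ = ⟨div v⟩_θ = 0`, `div(x_h/|x_h|²) = 0`);
* `norm_drift_le` — `‖b‖ ≤ D/(|x_h| + √(−s)) + |2 − A'|/r₀` for `|x_h| > r₀` under the axis-Type-I bound.

What remains for the one-sided Liouville theorem (recommended next for this seat): KNSS's plateau step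
(`…SourcedSwirlPlateau.exists_rescale_ge`) re-proved IN MEASURE from positivity propagation along chains of cylinders in the
rescaled annular box (AxisTwistDoor `…HarnackChainCore.chain_positivity` is abstract in the drift), and the estimates
(`…SourcedSwirlEstimates/…SourceEstimate/…Liouville`) re-run with an exceptional set of small measure (they use the plateau only
inside integrals against bounded weights, and `|F| ≤ D`).

Seat ns-hsw-p1 g4 (LEAD of 25311, cell pub-ns-dss).  WHAT THIS IS NOT: not a statement about Navier–Stokes regularity
(Clay A): pointwise calculus for HYPOTHETICAL blow-up profiles; no Liouville theorem is proved in this file; helper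
`--supports` 25311.
-/

noncomputable section

-- the summit and its single sub-problem share the name (CONVENTIONS §1), as in every Theorems file
set_option linter.dupNamespace false

namespace Summit.NavierStokesRegularity.NavierStokesRegularity.Theorems.HalfSpaceWindowDoorCirculationCarryingRigidityEddyTorqueOneSided

open MeasureTheory Set Function Filter Topology TopologicalSpace InnerProductSpace WithLp Metric
open scoped Laplacian RealInnerProductSpace ContDiff
open Literature.Analysis Literature.Analysis.FluidPDE
open Summit.NavierStokesRegularity.NavierStokesRegularity.Theorems.AxisTwistDoorAveragedConeLiouvilleDefs
  (cylPt circ vortCirc radVortCirc meanR meanZ remainder SignE3)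
open Summit.NavierStokesRegularity.NavierStokesRegularity.Theorems.AveragedConeLiouville.CircleStokes (deriv_circ_eq_vortCirc)
open Summit.NavierStokesRegularity.NavierStokesRegularity.Theorems.AveragedConeLiouville.CircleCalculus (deriv_circ_z)
open Summit.NavierStokesRegularity.NavierStokesRegularity.Theorems.AveragedConeLiouville.CircMonotone (vortCirc_nonneg)
open Summit.NavierStokesRegularity.NavierStokesRegularity.Theorems.AveragedConeLiouville.RadialDrift
  (norm_horizontal norm_radialDrift_le divergence_radialDrift contDiffOn_radialDrift)
open Summit.NavierStokesRegularity.NavierStokesRegularity.Theorems.HalfSpaceWindowDoorCirculationCarryingRigidityAxisCirculation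
  (isSmoothSpaceTimeOn_of_class hasDerivAt_circF_time laplacian_circF fderiv_circF_eR isSmoothSpaceTimeOn_circF contDiff_circF)
open Summit.NavierStokesRegularity.NavierStokesRegularity.Theorems.HalfSpaceWindowDoorCirculationCarryingRigidityAngularMeanDrift
  (fderiv_circF_angularMeanVec deriv_circ_s_eq_remainder isDivFree_angularMeanVec norm_angularMeanVec_le_axisBound
    contDiff_angularMeanVec_slice)

variable {C D : ℝ} {v : ℝ → EuclideanSpace ℝ (Fin 3) → EuclideanSpace ℝ (Fin 3)}

/-- The horizontal position vector `x_h = x₀e₀ + x₁e₁` is `r · e_r(x)` off the axis. -/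
theorem horizontal_eq_smul_eR {x : EuclideanSpace ℝ (Fin 3)} (hx : cylRadius x ≠ 0) :
    x 0 • EuclideanSpace.single (0 : Fin 3) (1 : ℝ) + x 1 • EuclideanSpace.single (1 : Fin 3) (1 : ℝ) = cylRadius x • eR x := by
  rw [eR, smul_smul, mul_inv_cancel₀ hx, one_smul]
  ext i; fin_cases i <;> simp

/-- **ONE-SIDED EDDY TORQUE ⇒ SUBSOLUTION WITH A DIVERGENCE-FREE DRIFT (pointwise form).**  For a profile of the door's
Type-I ancient Oseen-mild class and a point `x` off the axis, a time `s < 0`, and a constant `A'`: if on the axis circle through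
`x` the fluctuation remainder obeys the ONE-SIDED bound `ℛ ≤ (A'/r) ∮ω₃ dl` (eddy spin-up slaved to the vertical-vorticity flux;
no lower bound), then the lifted circulation `F(σ,y) = (2π)⁻¹Γ(|y_h|, y₂, σ)` satisfies at `(s,x)`
`∂ₛF − ΔF + DF[b] ≤ 0`, with the drift `b = ⟨v(s)⟩_θ(x) + ((2 − A')/r²)·x_h` — the angular mean of the velocity plus
AxisTwistDoor's radial comparison drift, BOTH divergence-free off the axis (`isDivFree_angularMeanVec`,
`…RadialDrift.divergence_radialDrift`).  This is the input format of the tree's positivity propagation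
(`AxisTwistDoor…Defs.PositivityPropagationFactC`, proved) for `V = M − F`: the one-sided engine recommended in the crux card. -/
theorem circF_subsolution_of_oneSided (hrate : HasTypeITimeDecay C v)
    (hcont : ContinuousOn (uncurry v) (Iio (0 : ℝ) ×ˢ univ))
    (hmild : ∀ s t : ℝ, s < t → t < 0 → ∀ x,
      v t x = UnboundedOperators.heatExtension (v s) (t - s) x - oseenDuhamel 1 s v v t x)
    (hdiv : ∀ t < 0, VectorCalculus.IsDivFree (v t)) {s : ℝ} (hs : s < 0)
    {x : EuclideanSpace ℝ (Fin 3)} (hx : cylRadius x ≠ 0) {A' : ℝ}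
    (heddy : remainder v (cylRadius x) (x 2) s ≤ A' / cylRadius x * vortCirc v (cylRadius x) (x 2) s) :
    deriv (fun σ => (2 * Real.pi)⁻¹ * circ v (cylRadius x) (x 2) σ) s
      - (Δ (fun y : EuclideanSpace ℝ (Fin 3) => (2 * Real.pi)⁻¹ * circ v (cylRadius y) (y 2) s)) x
      + fderiv ℝ (fun y : EuclideanSpace ℝ (Fin 3) => (2 * Real.pi)⁻¹ * circ v (cylRadius y) (y 2) s) x
          (angularMeanVec (v s) x + ((2 - A') / cylRadius x ^ 2) •
            (x 0 • EuclideanSpace.single (0 : Fin 3) (1 : ℝ) + x 1 • EuclideanSpace.single (1 : Fin 3) (1 : ℝ))) ≤ 0 := by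
  have hsm : IsSmoothSpaceTimeOn (Iio (0 : ℝ)) v := isSmoothSpaceTimeOn_of_class hrate hcont hmild hdiv
  have hr : 0 < cylRadius x := lt_of_le_of_ne (cylRadius_nonneg x) (Ne.symm hx)
  have hv1 : ContDiff ℝ 1 (v s) := (hsm.contDiff_slice hs).of_le (by norm_cast)
  -- the ingredients of the circle law, all at the circle through `x`
  have hd := deriv_circ_s_eq_remainder hrate hcont hmild hdiv hs hr (x 2)
  have hvr := deriv_circ_eq_vortCirc v hv1 (cylRadius x) (x 2)
  have hdz := deriv_circ_z v hv1 (cylRadius x) (x 2)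
  have hlap := laplacian_circF hsm hs hx
  have hD := fderiv_circF_angularMeanVec hsm hs hx
  have hR := fderiv_circF_eR hsm hs x
  have htime := (hasDerivAt_circF_time hsm hs x).deriv
  -- the drift term splits linearly; everything is evaluated on the circle through `x`
  rw [horizontal_eq_smul_eR hx, map_add, map_smul, map_smul, htime, hlap, hD, hR, hd, hvr, smul_eq_mul, smul_eq_mul]
  set P : ℝ := (2 * Real.pi)⁻¹ with hP
  set ρ : ℝ := cylRadius x with hρ
  set W : ℝ := vortCirc v ρ (x 2) s
  set Q : ℝ := radVortCirc v ρ (x 2) s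
  set Rm : ℝ := remainder v ρ (x 2) s
  set mR : ℝ := meanR v ρ (x 2) s
  set mZ : ℝ := meanZ v ρ (x 2) s
  set Grr : ℝ := deriv (fun r' => deriv (fun r'' => circ v r'' (x 2) s) r') ρ
  set Gzz : ℝ := deriv (fun z' => deriv (fun z'' => circ v ρ z'' s) z') (x 2)
  have hPpos : 0 < P := by rw [hP]; positivity
  have e : P * (Grr - ρ⁻¹ * W + Gzz + Rm - mR * W + mZ * Q) - P * (Grr + ρ⁻¹ * W + Gzz)
        + (P * (mR * W - mZ * Q) + (2 - A') / ρ ^ 2 * (ρ * (P * W)))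
      = P * (Rm - A' / ρ * W) := by
    field_simp
    ring
  rw [e]
  have hle : Rm - A' / ρ * W ≤ 0 := by linarith [heddy]
  exact mul_nonpos_iff.2 (Or.inl ⟨hPpos.le, hle⟩)

/-- **The drift is divergence-free off the axis.** -/
theorem divergence_drift_eq_zero (hrate : HasTypeITimeDecay C v)
    (hcont : ContinuousOn (uncurry v) (Iio (0 : ℝ) ×ˢ univ))
    (hmild : ∀ s t : ℝ, s < t → t < 0 → ∀ x,
      v t x = UnboundedOperators.heatExtension (v s) (t - s) x - oseenDuhamel 1 s v v t x)
    (hdiv : ∀ t < 0, VectorCalculus.IsDivFree (v t)) {s : ℝ} (hs : s < 0) (A' : ℝ)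
    {x : EuclideanSpace ℝ (Fin 3)} (hx : cylRadius x ≠ 0) :
    VectorCalculus.divergence (fun y : EuclideanSpace ℝ (Fin 3) => angularMeanVec (v s) y + ((2 - A') / cylRadius y ^ 2) •
        (y 0 • EuclideanSpace.single (0 : Fin 3) (1 : ℝ) + y 1 • EuclideanSpace.single (1 : Fin 3) (1 : ℝ))) x = 0 := by
  have hsm : IsSmoothSpaceTimeOn (Iio (0 : ℝ)) v := isSmoothSpaceTimeOn_of_class hrate hcont hmild hdiv
  have hr : 0 < cylRadius x := lt_of_le_of_ne (cylRadius_nonneg x) (Ne.symm hx)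
  have h1 : DifferentiableAt ℝ (angularMeanVec (v s)) x :=
    ((contDiff_angularMeanVec_slice hsm hs).differentiable (by simp)).differentiableAt
  have hopen : IsOpen {y : EuclideanSpace ℝ (Fin 3) | cylRadius x / 2 < cylRadius y} :=
    isOpen_lt continuous_const continuous_cylRadius
  have hmem : x ∈ {y : EuclideanSpace ℝ (Fin 3) | cylRadius x / 2 < cylRadius y} := by
    show cylRadius x / 2 < cylRadius x; linarith
  have h2 : DifferentiableAt ℝ (fun y : EuclideanSpace ℝ (Fin 3) => ((2 - A') / cylRadius y ^ 2) •
      (y 0 • EuclideanSpace.single (0 : Fin 3) (1 : ℝ) + y 1 • EuclideanSpace.single (1 : Fin 3) (1 : ℝ))) x :=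
    ((contDiffOn_radialDrift (2 - A') (half_pos hr)).differentiableOn one_ne_zero x hmem).differentiableAt (hopen.mem_nhds hmem)
  have hsum : HasFDerivAt (fun y : EuclideanSpace ℝ (Fin 3) => angularMeanVec (v s) y + ((2 - A') / cylRadius y ^ 2) •
        (y 0 • EuclideanSpace.single (0 : Fin 3) (1 : ℝ) + y 1 • EuclideanSpace.single (1 : Fin 3) (1 : ℝ)))
      (fderiv ℝ (angularMeanVec (v s)) x + fderiv ℝ (fun y : EuclideanSpace ℝ (Fin 3) => ((2 - A') / cylRadius y ^ 2) •
        (y 0 • EuclideanSpace.single (0 : Fin 3) (1 : ℝ) + y 1 • EuclideanSpace.single (1 : Fin 3) (1 : ℝ))) x) x :=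
    h1.hasFDerivAt.add h2.hasFDerivAt
  rw [VectorCalculus.divergence, hsum.fderiv, ContinuousLinearMap.toLinearMap_add, map_add]
  have hA := isDivFree_angularMeanVec hsm hdiv hs x
  have hB := divergence_radialDrift (2 - A') hx
  rw [VectorCalculus.divergence] at hA hB
  rw [hA, hB, add_zero]

/-- **The drift is bounded off a tube** under the axis-Type-I bound: `‖b(s,x)‖ ≤ D/(|x_h| + √(−s)) + |2 − A'|/r₀` for
`|x_h| > r₀ > 0`. -/
theorem norm_drift_le (hDax : ∀ t < 0, ∀ x : EuclideanSpace ℝ (Fin 3), ‖v t x‖ ≤ D / (cylRadius x + Real.sqrt (-t)))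
    {s : ℝ} (hs : s < 0) (A' : ℝ) {r₀ : ℝ} (hr₀ : 0 < r₀) {x : EuclideanSpace ℝ (Fin 3)} (hx : r₀ < cylRadius x) :
    ‖angularMeanVec (v s) x + ((2 - A') / cylRadius x ^ 2) •
        (x 0 • EuclideanSpace.single (0 : Fin 3) (1 : ℝ) + x 1 • EuclideanSpace.single (1 : Fin 3) (1 : ℝ))‖ ≤
      D / (cylRadius x + Real.sqrt (-s)) + |2 - A'| / r₀ :=
  (norm_add_le _ _).trans (add_le_add (norm_angularMeanVec_le_axisBound hDax hs x) (norm_radialDrift_le (2 - A') hr₀ hx))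

end Summit.NavierStokesRegularity.NavierStokesRegularity.Theorems.HalfSpaceWindowDoorCirculationCarryingRigidityEddyTorqueOneSided

end
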